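import Summits.AtomisticToContinuum.BoseEinsteinCondensation.Theses.BECModePrice

/-!
# Ideator k4 (gen 4) sketch — crux `ModePriceHardCore` (stmt-AtomisticToContinuum-18513)

Two statements recorded for the tenure planner (see MEMO-r4-k4.md):

* `BallPriceLeadingOrder` — the price of half-softening the WHOLE ball of plane-wave modes
  `|2πp/L|² ≤ M ρ^{2/3}` is at most a vanishing FRACTION `θ·E₀` of the ground-state energy
  (leading-order energy asymptotics with an infrared-dented dispersion; claimed provable from
  LiebYngvason1998 + the momentum-cutoff Dyson lemma, Lieb–Seiringer CMP 264 (2006) Lemma 1).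
* `IRWindowModePrice` — the single-mode softening statement (SMS) of the route restricted to the
  infrared window `N·ε_p ≤ c_w·E₀` for SOME window constant `c_w > 0` of the prover's choosing;
  `irWindow_of_modePrice` certifies that it is a weakening of the crux pair
  (`ModePriceIntegrable`, `ModePriceHardCore`).
-/

namespace Summit.AtomisticToContinuum.BoseEinsteinCondensation.Cruxes.ModePriceHardCore.IdeatorK4g4

open Literature.MathematicalPhysics.QuantumManyBody.BoseGas

/-- normalised plane wave `L^{-3/2} e^{2πi p·x/L}` on the torus of side `L` (the crux's inlined mode). -/
noncomputable def planeWave (L : ℝ) (p : Fin 3 → ℤ) : EuclideanSpace ℝ (Fin 3) → ℂ :=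
  fun x => ((Real.sqrt (L ^ 3))⁻¹ : ℂ) *
    Complex.exp (2 * Real.pi * Complex.I * ((∑ k : Fin 3, ((p k : ℤ) : ℝ) * x k : ℝ) : ℂ) / (L : ℂ))

/-- bare dispersion `ε_p = |2πp/L|²` (units ħ = 2m = 1), as inlined in the crux. -/
noncomputable def dispersion (L : ℝ) (p : Fin 3 → ℤ) : ℝ :=
  (2 * Real.pi / L * Real.sqrt (∑ k : Fin 3, ((p k : ℤ) : ℝ) ^ 2)) ^ (2 : ℝ)

/-- BALL PRICE AT LEADING ORDER (candidate support item, claimed provable now).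
For every admissible `v`, every fraction `θ > 0` and every ball constant `M > 0` there is `ρ₀ > 0`
such that for `0 < ρ < ρ₀`, eventually in `N`, for every finite set `S` of non-zero lattice momenta
with `ε_p ≤ M ρ^{2/3}` and every periodic trial state `Ψ`:
`E₀^per + ½ Σ_{p ∈ S} ε_p n_p(Ψ) ≤ ⟨Ψ,HΨ⟩ + θ·E₀^per`,
i.e. `inf spec (H − ½ T_{ball}) ≥ (1 − θ) E₀^per`: halving the kinetic energy of ALL modes below the
free scale `ρ^{1/3}` lowers the ground-state energy by at most the fraction `θ`. -/
def BallPriceLeadingOrder : Prop :=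
  ∀ v : ℝ → ENNReal, IsRepulsiveFiniteRange v → ∀ θ : ℝ, 0 < θ → ∀ M : ℝ, 0 < M →
    ∃ ρ₀ : ℝ, 0 < ρ₀ ∧ ∀ ρ : ℝ, 0 < ρ → ρ < ρ₀ →
      ∀ᶠ N : ℕ in Filter.atTop, ∀ S : Finset (Fin 3 → ℤ),
        (∀ p ∈ S, p ≠ 0 ∧ dispersion (sideLength ρ N) p ≤ M * ρ ^ ((2 : ℝ) / 3)) →
        ∀ Ψ : PeriodicTrialState N (sideLength ρ N),
          periodicGroundStateEnergy v N (sideLength ρ N)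
            + 2⁻¹ * ∑ p ∈ S, ENNReal.ofReal (dispersion (sideLength ρ N) p)
                * cellOccupation N (sideLength ρ N) (planeWave (sideLength ρ N) p) Ψ.ψ
          ≤ periodicEnergy v Ψ
            + ENNReal.ofReal θ * periodicGroundStateEnergy v N (sideLength ρ N)

/-- INFRARED-WINDOW SINGLE-MODE SOFTENING (candidate restatement of the crux pair, WEAKER).
For every admissible `v` there are a window constant `c_w > 0`, a price constant `C > 0` and
`ρ₀ > 0` such that for `0 < ρ < ρ₀`, eventually in `N`, for every non-zero lattice momentum `p` in the
infrared window `N·ε_p ≤ c_w·E₀^per` and every periodic trial state `Ψ`: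
`E₀^per + ½ ε_p n_p(Ψ) ≤ ⟨Ψ,HΨ⟩ + Cρ`. -/
def IRWindowModePrice : Prop :=
  ∀ v : ℝ → ENNReal, IsRepulsiveFiniteRange v → ∃ cw : ℝ, 0 < cw ∧ ∃ C : ℝ, 0 < C ∧
    ∃ ρ₀ : ℝ, 0 < ρ₀ ∧ ∀ ρ : ℝ, 0 < ρ → ρ < ρ₀ →
      ∀ᶠ N : ℕ in Filter.atTop, ∀ p : Fin 3 → ℤ, p ≠ 0 →
        ENNReal.ofReal ((N : ℝ) * dispersion (sideLength ρ N) p)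
            ≤ ENNReal.ofReal cw * periodicGroundStateEnergy v N (sideLength ρ N) →
        ∀ Ψ : PeriodicTrialState N (sideLength ρ N),
          periodicGroundStateEnergy v N (sideLength ρ N)
            + 2⁻¹ * ENNReal.ofReal (dispersion (sideLength ρ N) p)
                * cellOccupation N (sideLength ρ N) (planeWave (sideLength ρ N) p) Ψ.ψ
          ≤ periodicEnergy v Ψ + ENNReal.ofReal (C * ρ)

/-- The crux pair (integrable + hard-core SMS, all modes) implies the infrared-window restatement:
the latter is a RESTRICTION of the former (any window constant, here `c_w = 1`). -/
theorem irWindow_of_modePrice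
    (h1 : Theses.BECModePrice.ModePriceIntegrable) (h2 : Theses.BECModePrice.ModePriceHardCore) :
    IRWindowModePrice := by
  intro v hv
  by_cases hint : (∫⁻ x : EuclideanSpace ℝ (Fin 3), v ‖x‖) = ⊤
  · obtain ⟨C, hC, ρ₀, hρ₀, h⟩ := h2 v hv hint
    refine ⟨1, one_pos, C, hC, ρ₀, hρ₀, fun ρ hρ hρ' => ?_⟩
    filter_upwards [h ρ hρ hρ'] with N hN p hp _ Ψ
    exact hN p hp Ψ
  · obtain ⟨C, hC, ρ₀, hρ₀, h⟩ := h1 v hv hint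
    refine ⟨1, one_pos, C, hC, ρ₀, hρ₀, fun ρ hρ hρ' => ?_⟩
    filter_upwards [h ρ hρ hρ'] with N hN p hp _ Ψ
    exact hN p hp Ψ

end Summit.AtomisticToContinuum.BoseEinsteinCondensation.Cruxes.ModePriceHardCore.IdeatorK4g4
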